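import Summits.HodgeConjecture.CorCM.IrreducibleOddWeightsRightIdealsQuadratic
import Summits.HodgeConjecture.CorCM.IrreducibleOddWeightsRightIdealsCharactersCMFields
import Literature.AlgebraicGeometry.Pohlmann1968.NondegenerateCMTypeDivisorGenerated
import HarnessLib

/-!
# Right ideals, VIII: a NONDEGENERATE GALOIS partner detects exactly the Hecke rank of the shadow —
# `dim Hg(A₀) + dim Hg(A₁) − dim Hg(A₀ × A₁) = dim(w₀ℚ[Gal(K₁/ℚ)])` whenever `K₁ ↪ K₀` is Galois and `Φ₁` nondegenerate

COR-CM (cell `pub-hodgecm2`, binder seat `b16` gen 64, count-neutral claim RIGHT IDEALS, file R8 — CM fields; theorems only,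
no definition, no named fact, no `sorry`).  NEW as stated, hence under `Summits/`.  HONEST FRAMING: an exact formula for the
codimension of `Hg(A₀ × A₁)` in `Hg(A₀) × Hg(A₁)` when `A₁` has CM by a GALOIS CM field `K₁` embedded in `K₀` and a
NONDEGENERATE type; it sharpens gen 62's `IrreducibleOddWeightsOrbitBalanceConverse` (additive iff the shadow of `Φ₀` on
`K₁` vanishes) to the exact count; `HC_CM` is neither used nor asserted.

SETTING (R4 `…RightIdealsPivotCMFields` with the pivot `M = K₁` itself).  `I = {i₀, i₁}`, `j : K₁ → K₀`, `z₀ : K₁ → ℂ`,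
`K₁` Galois; the shadow `w₀(z) = Σ_{t | t∘j = z} u_1(Φ₀)(t) = 2·#{t ∈ Φ₀ : t|_{K₁} = z} − [K₀:K₁]` on `Hom(K₁, ℂ)` and its
Hecke module `H₀ = span{w₀(· ∘ δ) : δ ∈ Gal(K₁/ℚ)} = w₀ℚ[Gal(K₁/ℚ)]`.  The hypothesis of R4 on the Galois closures is
AUTOMATIC here (`L₁ = z₀(K₁)`).

* §1 `span_precomp_shadow_id_eq_antiWeights` — for the slot `K₁` itself (`j₁ = id`) the Hecke module of a NONDEGENERATE
  type is ALL of `Anti(Hom(K₁, ℂ))` (gen 62's `span_precomp_antiVec_eq_antiWeights`), while every Hecke module of a shadow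
  lies in `Anti` (R7: shadows are odd; `span_precomp_shadow_le_antiWeights`).
* §2 **`cmTypeRank_add_cmTypeRank_eq_add_finrank_hecke_of_isNondegenerate`** — `cmTypeRank Φ₀ + cmTypeRank Φ₁ =
  cmFamilyRank Φ + 1 + dim H₀`: **`dim Hg(A₀) + dim Hg(A₁) − dim Hg(A₀ × A₁) = dim(w₀ℚ[Gal(K₁/ℚ)])`**, the Hecke rank of the
  shadow of `Φ₀` on `K₁`; equivalently (`cmFamilyRank_add_finrank_hecke_eq_of_isNondegenerate`)
  **`dim Hg(A₀ × A₁) = dim Hg(A₀) + [K₁:ℚ]/2 − dim(w₀ℚ[Gal(K₁/ℚ)])`**.  Gen 62's converse is the case `w₀ = 0`; gen 62 O3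
  (`Φ₀` equidistributed over `K₁` ⟹ additive) is the same case read backwards.
* §3 **`cmTypeRank_add_cmTypeRank_eq_add_ncard_of_isNondegenerate_of_isAbelianGalois`** — `K₁` ABELIAN: the drop is
  **`#S₀`, the number of characters of `Gal(K₁/ℚ)` seen by the shadow of `Φ₀`** (R6b); and for `K₁ = k` imaginary quadratic
  (`A₁ = E_k`, every type nondegenerate): the drop is `[d₀ ≠ 0]` (R7) — Moonen–Zarhin's `A × E_k`.

## References

* [Kubota1965] T. Kubota, *On the field extension by complex multiplication*, Trans. AMS 118 (1965), §2 Lemma 1–2, §4.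
* [Gordon1999HodgeAVSurvey] B. B. Gordon, *A survey of the Hodge conjecture for abelian varieties*, §3 Theorem (proof),
  7.5–7.7, 9.4.1, 9.4.3.
* [MoonenZarhin1999LowDim] B. Moonen, Yu. Zarhin, *Hodge classes on abelian varieties of low dimension*, Thm. (0.1) (a), §3.
* [Shimura1998] G. Shimura, *Abelian Varieties with Complex Multiplication and Modular Functions*, §8.1, §32.10.
-/

set_option autoImplicit false

noncomputable section

open scoped BigOperators Classical

open CategoryTheory CategoryTheory.Limits NumberField NumberField.ComplexEmbedding Module IntermediateField

namespace Summit.HodgeConjecture.CorCM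

open Literature.NumberTheory.ComplexMultiplication
open Literature.AlgebraicGeometry.Motives (AbelianVariety CMType)
open Literature.AlgebraicGeometry.Pohlmann1968

/-! ### §1 The Hecke modules inside `Anti(Hom(K₁, ℂ))` -/

section Anti

variable {K : Type} [Field K] [NumberField K] {M : Type} [Field M] [NumberField M]

omit [NumberField K] [NumberField M] in
/-- On `Hom(M, ℂ)` complex conjugation acts by `z ↦ z̄`. [folklore] -/
theorem starRingAut_smul_eq_conjugate (z : M →+* ℂ) : (starRingAut : ℂ ≃+* ℂ) • z = conjugate z :=
  RingHom.ext fun _ => rfl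

/-- **Every Hecke module of a shadow lies in `Anti`** (shadows and their Hecke translates are odd, R7).
[cite: Shimura1998, §18.1] -/
theorem span_precomp_shadow_le_antiWeights (Φ : CMType K) (j : M →+* K) :
    Submodule.span ℚ (Set.range fun δ : M ≃ₐ[ℚ] M => fun z : M →+* ℂ =>
        ∑ t ∈ Finset.univ.filter (fun t : K →+* ℂ => t.comp j = z.comp (δ : M →+* M)), antiVec Φ.1 (1 : ℂ ≃+* ℂ) t) ≤
      antiWeights (E := M →+* ℂ) (starRingAut : ℂ ≃+* ℂ) := by
  intro f hf
  rw [mem_antiWeights_iff']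
  intro z
  rw [starRingAut_smul_eq_conjugate]
  exact apply_conjugate_eq_neg_of_mem_span_precomp_shadow Φ j hf z

/-- For the slot `M` itself (`j = id`) the fibre sum is the single value `u_1(Ψ)(z ∘ δ)`. [folklore] -/
theorem sum_filter_comp_id_eq (Ψ : CMType M) (y : M →+* ℂ) :
    ∑ t ∈ Finset.univ.filter (fun t : M →+* ℂ => t.comp (RingHom.id M) = y), antiVec Ψ.1 (1 : ℂ ≃+* ℂ) t =
      antiVec Ψ.1 (1 : ℂ ≃+* ℂ) y := by
  have hfilter : Finset.univ.filter (fun t : M →+* ℂ => t.comp (RingHom.id M) = y) = {y} := by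
    ext t
    simp only [Finset.mem_filter, Finset.mem_univ, true_and, RingHom.comp_id, Finset.mem_singleton]
  rw [hfilter, Finset.sum_singleton]

/-- **For a NONDEGENERATE type of the GALOIS field `M` itself the Hecke module is all of `Anti`** (gen 62's
`span_precomp_antiVec_eq_antiWeights`, read with `j = id`). [cite: Kubota1965, §2 Lemma 1] [cite: Shimura1998, §32.10] -/
theorem span_precomp_shadow_id_eq_antiWeights [IsCMField M] [IsGalois ℚ M] (Ψ : CMType M) (hnd : IsNondegenerate Ψ) :
    Submodule.span ℚ (Set.range fun δ : M ≃ₐ[ℚ] M => fun z : M →+* ℂ =>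
        ∑ t ∈ Finset.univ.filter (fun t : M →+* ℂ => t.comp (RingHom.id M) = z.comp (δ : M →+* M)),
          antiVec Ψ.1 (1 : ℂ ≃+* ℂ) t) =
      antiWeights (E := M →+* ℂ) (starRingAut : ℂ ≃+* ℂ) := by
  rw [← span_precomp_antiVec_eq_antiWeights Ψ hnd]
  congr 1
  refine Set.ext fun c => ⟨?_, ?_⟩
  · rintro ⟨δ, rfl⟩
    exact ⟨δ, funext fun z => (sum_filter_comp_id_eq Ψ _).symm⟩
  · rintro ⟨δ, rfl⟩
    exact ⟨δ, funext fun z => sum_filter_comp_id_eq Ψ _⟩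

end Anti

/-! ### §2 The exact drop against a nondegenerate Galois partner -/

section Rank

variable {I : Type} [Fintype I] {K : I → Type} [∀ i, Field (K i)] [∀ i, NumberField (K i)] [∀ i, IsCMField (K i)]

/-- **A NONDEGENERATE GALOIS PARTNER DETECTS EXACTLY THE HECKE RANK OF THE SHADOW.**  `I = {i₀, i₁}`, `K_{i₁}` Galois with
`j : K_{i₁} → K_{i₀}`, `Φ_{i₁}` nondegenerate, `z₀ : K_{i₁} → ℂ`.  Then
`cmTypeRank Φ₀ + cmTypeRank Φ₁ = cmFamilyRank Φ + 1 + dim H₀` with `H₀ = span{w₀(· ∘ δ) : δ ∈ Gal(K₁/ℚ)}` the Hecke module of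
the shadow `w₀(z) = 2·#{t ∈ Φ₀ : t|_{K₁} = z} − [K₀:K₁]`: **`dim Hg(A₀) + dim Hg(A₁) − dim Hg(A₀ × A₁) = dim(w₀ℚ[Gal(K₁/ℚ)])`**.
(R4 with the pivot `K₁`: the second Hecke module is `Anti ⊇ H₀`.) [cite: Kubota1965, §2 Lemma 1–2 and §4]
[cite: Gordon1999HodgeAVSurvey, §3 Theorem (proof), 7.5–7.7 and 9.4.3] [cite: Shimura1998, §32.10] -/
theorem cmTypeRank_add_cmTypeRank_eq_add_finrank_hecke_of_isNondegenerate {i₀ i₁ : I} (h01 : i₀ ≠ i₁)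
    (hI : ∀ l, l = i₀ ∨ l = i₁) [IsGalois ℚ (K i₁)] (Φ : ∀ i, CMType (K i)) (hnd : IsNondegenerate (Φ i₁))
    (j : K i₁ →+* K i₀) (z₀ : K i₁ →+* ℂ) :
    cmTypeRank (Φ i₀) + cmTypeRank (Φ i₁) = CMAlgebra.cmFamilyRank Φ + 1 +
      Module.finrank ℚ (Submodule.span ℚ (Set.range fun δ : K i₁ ≃ₐ[ℚ] K i₁ => fun z : K i₁ →+* ℂ =>
        ∑ t ∈ Finset.univ.filter (fun t : K i₀ →+* ℂ => t.comp j = z.comp (δ : K i₁ →+* K i₁)),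
          antiVec (Φ i₀).1 (1 : ℂ ≃+* ℂ) t)) := by
  have hmeet : ∀ z : ℂ, z ∈ normalClosure ℚ (K i₀) ℂ → z ∈ normalClosure ℚ (K i₁) ℂ → z ∈ Set.range z₀ :=
    fun z _ hz => normalClosure_le_range_of_normal z₀ hz
  rw [cmTypeRank_add_cmTypeRank_eq_cmFamilyRank_add_one_add_finrank_inf h01 hI Φ j (RingHom.id (K i₁)) z₀ hmeet,
    span_precomp_shadow_id_eq_antiWeights (Φ i₁) hnd,
    inf_eq_left.2 (span_precomp_shadow_le_antiWeights (Φ i₀) j)]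

/-- **`dim Hg(A₀ × A₁) + dim(w₀ℚ[Gal(K₁/ℚ)]) = dim Hg(A₀) + [K₁:ℚ]/2`** — the same with `dim Hg(A₁) = [K₁:ℚ]/2` substituted:
`cmFamilyRank Φ + 1 + dim H₀ = cmTypeRank Φ₀ + [K₁:ℚ]/2`. [cite: Kubota1965, §2] [cite: Gordon1999HodgeAVSurvey, 7.5–7.7 and 9.4.3] -/
theorem cmFamilyRank_add_finrank_hecke_eq_of_isNondegenerate {i₀ i₁ : I} (h01 : i₀ ≠ i₁)
    (hI : ∀ l, l = i₀ ∨ l = i₁) [IsGalois ℚ (K i₁)] (Φ : ∀ i, CMType (K i)) (hnd : IsNondegenerate (Φ i₁))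
    (j : K i₁ →+* K i₀) (z₀ : K i₁ →+* ℂ) :
    CMAlgebra.cmFamilyRank Φ + 1 +
        Module.finrank ℚ (Submodule.span ℚ (Set.range fun δ : K i₁ ≃ₐ[ℚ] K i₁ => fun z : K i₁ →+* ℂ =>
          ∑ t ∈ Finset.univ.filter (fun t : K i₀ →+* ℂ => t.comp j = z.comp (δ : K i₁ →+* K i₁)),
            antiVec (Φ i₀).1 (1 : ℂ ≃+* ℂ) t)) =
      cmTypeRank (Φ i₀) + finrank ℚ (K i₁) / 2 + 1 := by
  have h := cmTypeRank_add_cmTypeRank_eq_add_finrank_hecke_of_isNondegenerate h01 hI Φ hnd j z₀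
  have h1 : cmTypeRank (Φ i₁) = finrank ℚ (K i₁) / 2 + 1 := hnd
  omega

/-- **`Hg(A₀ × A₁) = Hg(A₀) × Hg(A₁)` iff the Hecke module of the shadow vanishes iff the shadow vanishes** — gen 62's
converse (`IrreducibleOddWeightsOrbitBalanceConverse`) as the case `dim H₀ = 0`. [cite: Kubota1965, §4 Lemma 2]
[cite: Gordon1999HodgeAVSurvey, §3 Theorem and 7.5–7.7] -/
theorem cmFamilyRank_add_card_eq_iff_finrank_hecke_eq_zero_of_isNondegenerate {i₀ i₁ : I} (h01 : i₀ ≠ i₁)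
    (hI : ∀ l, l = i₀ ∨ l = i₁) [IsGalois ℚ (K i₁)] (Φ : ∀ i, CMType (K i)) (hnd : IsNondegenerate (Φ i₁))
    (j : K i₁ →+* K i₀) (z₀ : K i₁ →+* ℂ) :
    CMAlgebra.cmFamilyRank Φ + Fintype.card I = (∑ i, cmTypeRank (Φ i)) + 1 ↔
      Module.finrank ℚ (Submodule.span ℚ (Set.range fun δ : K i₁ ≃ₐ[ℚ] K i₁ => fun z : K i₁ →+* ℂ =>
        ∑ t ∈ Finset.univ.filter (fun t : K i₀ →+* ℂ => t.comp j = z.comp (δ : K i₁ →+* K i₁)),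
          antiVec (Φ i₀).1 (1 : ℂ ≃+* ℂ) t)) = 0 := by
  have h := cmTypeRank_add_cmTypeRank_eq_add_finrank_hecke_of_isNondegenerate h01 hI Φ hnd j z₀
  have hcard : Fintype.card I = 2 := by
    rw [← Finset.card_univ, show (Finset.univ : Finset I) = {i₀, i₁} from Finset.ext fun l => by
      simpa only [Finset.mem_univ, Finset.mem_insert, Finset.mem_singleton, true_iff] using hI l,
      Finset.card_pair h01]
  rw [IrrOdd.sum_eq_add_of_pair _ hI h01, hcard]
  omega

/-! ### §3 Abelian and quadratic Galois partners -/

open scoped IsMulCommutative in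
/-- **An ABELIAN nondegenerate partner: the drop is the number of characters of `Gal(K₁/ℚ)` seen by the shadow of `Φ₀`** —
`cmTypeRank Φ₀ + cmTypeRank Φ₁ = cmFamilyRank Φ + 1 + #S₀`, `S₀ = {χ : Σ_γ W₀(γ)χ(γ) ≠ 0}`, `W₀(γ) = w₀(z₀ ∘ γ)`.
[cite: Kubota1965, §4 Lemma 2] [cite: Gordon1999HodgeAVSurvey, Prop. 9.4.1 and 7.5–7.7] -/
theorem cmTypeRank_add_cmTypeRank_eq_add_ncard_of_isNondegenerate_of_isAbelianGalois {i₀ i₁ : I} (h01 : i₀ ≠ i₁)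
    (hI : ∀ l, l = i₀ ∨ l = i₁) [IsAbelianGalois ℚ (K i₁)] (Φ : ∀ i, CMType (K i)) (hnd : IsNondegenerate (Φ i₁))
    (j : K i₁ →+* K i₀) (z₀ : K i₁ →+* ℂ) :
    cmTypeRank (Φ i₀) + cmTypeRank (Φ i₁) = CMAlgebra.cmFamilyRank Φ + 1 +
      {χ : AddChar (Additive (K i₁ ≃ₐ[ℚ] K i₁)) ℂ | ∑ γ : K i₁ ≃ₐ[ℚ] K i₁,
        ((∑ t ∈ Finset.univ.filter (fun t : K i₀ →+* ℂ => t.comp j = z₀.comp (γ : K i₁ →+* K i₁)),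
          antiVec (Φ i₀).1 (1 : ℂ ≃+* ℂ) t : ℚ) : ℂ) * χ (Additive.ofMul γ) ≠ 0}.ncard := by
  rw [← finrank_span_precomp_shadow_eq_ncard (Φ i₀) j z₀]
  exact cmTypeRank_add_cmTypeRank_eq_add_finrank_hecke_of_isNondegenerate h01 hI Φ hnd j z₀

/-- **An imaginary QUADRATIC partner (`A₁ = E_k`, `k ↪ K₀`): the drop is `[d₀ ≠ 0]`** — `cmTypeRank Φ₀ + cmTypeRank Φ₁ =
cmFamilyRank Φ + 1 + [W₀ ≠ 0]` with `W₀ = Σ_{t | t∘j = z₀} u_1(Φ₀)(t)` the signature defect of `Φ₀` on `k` (every type of `k`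
is nondegenerate): Moonen–Zarhin's `A × E`, exactly. [cite: MoonenZarhin1999LowDim, Thm. (0.1) (a) and §3]
[cite: Gordon1999HodgeAVSurvey, §3 Theorem (proof), 7.5–7.7 and 9.4.3] -/
theorem cmTypeRank_add_cmTypeRank_eq_add_ite_of_finrank_eq_two {i₀ i₁ : I} (h01 : i₀ ≠ i₁)
    (hI : ∀ l, l = i₀ ∨ l = i₁) (hk : finrank ℚ (K i₁) = 2) (Φ : ∀ i, CMType (K i)) (j : K i₁ →+* K i₀)
    (z₀ : K i₁ →+* ℂ) :
    cmTypeRank (Φ i₀) + cmTypeRank (Φ i₁) = CMAlgebra.cmFamilyRank Φ + 1 +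
      if ∑ t ∈ Finset.univ.filter (fun t : K i₀ →+* ℂ => t.comp j = z₀), antiVec (Φ i₀).1 (1 : ℂ ≃+* ℂ) t = 0
      then 0 else 1 := by
  haveI := isGalois_of_finrank_eq_two hk
  rw [cmTypeRank_add_cmTypeRank_eq_add_finrank_hecke_of_isNondegenerate h01 hI Φ
    (isNondegenerate_of_finrank_eq_two (Φ i₁) hk) j z₀, finrank_span_precomp_shadow_eq hk (Φ i₀) j z₀]

end Rank

end Summit.HodgeConjecture.CorCM

end
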